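import Summits.Ventures.PercRepro.Night2FatDegLarge

/-!
# night-2: the doubly degenerate regime for large `N` — the numerics

For `N ≥ 11` (`m = N − 1 ≥ 10` points in `W ∖ {x}`) the fair share of a lossy basis pair of the doubly degenerate
regime needs only the levels `1, 2, 3, 4` with the capacity `11/18` throughout:
`(110/221)·(1 + e/5 + u₃/15 + u₄/35) ≥ 1 ⇔ 21 e + 7 u₃ + 3 u₄ ≥ 106` (**`dd_bridge_large`**).  The three cases:
* no heavy side line (a side line is HEAVY when it is non-class with two basis points): every singleton is unloaded,
  `e = m ≥ 10`;
* one heavy side line `clF A`: the singletons off it, `e = q = m − s₂ ≥ 3`, and the triples with two points of the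
  `A`-cell and a point off `clF A`, `u₄ = C(t_A, 2) · q` (**`dd_large_one`**);
* both side lines heavy: the singletons off both, `e ≥ m − s₂ − s₃`, the pairs and the triples meeting both side
  cells, `u₃ = t_A t_M`, `u₄ = t_A t_M t_L` (**`dd_large_both`**, from the cell facts).
Paper `proofs/NIGHT-2-g36.md` §1.
-/

namespace PercRepro.Shadow

/-- **The bridge for large `N`**: `21 e + 7 u₃ + 3 u₄ ≥ 106` with `u₃ ≤ s 3`, `u₄ ≤ s 4` gives the fair-share sum
`1 ≤ fatTerm 1 + e · fatTerm 2 + ∑_{j = 3}^{N} s j · fatTerm j` (`N ≥ 4`). -/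
theorem dd_bridge_large (N e u₃ u₄ : ℕ) (s : ℕ → ℕ) (hN : 4 ≤ N) (h3 : u₃ ≤ s 3) (h4 : u₄ ≤ s 4)
    (hD : 106 ≤ 21 * e + 7 * u₃ + 3 * u₄) :
    (1 : ℚ) ≤ fatTerm 1 (if N - 1 ≤ 3 then 1 else 11 / 18) +
      (e : ℚ) * fatTerm 2 (if N - 2 ≤ 3 then 1 else 11 / 18) +
      ∑ j ∈ Finset.Icc 3 N, ((s j : ℕ) : ℚ) * fatTerm j (if N - j ≤ 3 then 1 else 11 / 18) := by
  have hsub : ({3, 4} : Finset ℕ) ⊆ Finset.Icc 3 N := by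
    intro j hj
    simp only [Finset.mem_insert, Finset.mem_singleton] at hj
    rw [Finset.mem_Icc]
    omega
  have hnn : ∀ j ∈ Finset.Icc 3 N, j ∉ ({3, 4} : Finset ℕ) →
      (0 : ℚ) ≤ ((s j : ℕ) : ℚ) * fatTerm j (if N - j ≤ 3 then 1 else 11 / 18) := by
    intro j _ _
    apply mul_nonneg (by positivity)
    unfold fatTerm
    split_ifs <;> positivity
  have hsum := Finset.sum_le_sum_of_subset_of_nonneg hsub hnn
  rw [Finset.sum_pair (by norm_num)] at hsum
  have f1 := fatTerm_le_fatTerm_if' 1 N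
  have f2 := fatTerm_le_fatTerm_if' 2 N
  have f3 := fatTerm_le_fatTerm_if' 3 N
  have f4 := fatTerm_le_fatTerm_if' 4 N
  have q3 : ((u₃ : ℕ) : ℚ) ≤ s 3 := by exact_mod_cast h3
  have q4 : ((u₄ : ℕ) : ℚ) ≤ s 4 := by exact_mod_cast h4
  have qD : (106 : ℚ) ≤ 21 * e + 7 * u₃ + 3 * u₄ := by exact_mod_cast hD
  have e0 : (0 : ℚ) ≤ e := by positivity
  have s30 : (0 : ℚ) ≤ s 3 := by positivity
  have s40 : (0 : ℚ) ≤ s 4 := by positivity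
  have g2 : (e : ℚ) * fatTerm 2 (11 / 18) ≤ (e : ℚ) * fatTerm 2 (if N - 2 ≤ 3 then 1 else 11 / 18) :=
    mul_le_mul_of_nonneg_left f2 e0
  have g3 : ((s 3 : ℕ) : ℚ) * fatTerm 3 (11 / 18) ≤ ((s 3 : ℕ) : ℚ) * fatTerm 3 (if N - 3 ≤ 3 then 1 else 11 / 18) :=
    mul_le_mul_of_nonneg_left f3 s30
  have g4 : ((s 4 : ℕ) : ℚ) * fatTerm 4 (11 / 18) ≤ ((s 4 : ℕ) : ℚ) * fatTerm 4 (if N - 4 ≤ 3 then 1 else 11 / 18) :=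
    mul_le_mul_of_nonneg_left f4 s40
  have v1 : fatTerm 1 (11 / 18) = 110 / 221 := by unfold fatTerm; norm_num [Nat.choose]
  have v2 : fatTerm 2 (11 / 18) = 22 / 221 := by unfold fatTerm; norm_num [Nat.choose]
  have v3 : fatTerm 3 (11 / 18) = 22 / 663 := by unfold fatTerm; norm_num [Nat.choose]
  have v4 : fatTerm 4 (11 / 18) = 22 / 1547 := by unfold fatTerm; norm_num [Nat.choose]
  rw [v1] at f1
  rw [v2] at g2
  rw [v3] at g3
  rw [v4] at g4
  have h3' : ((u₃ : ℕ) : ℚ) * (22 / 663) ≤ ((s 3 : ℕ) : ℚ) * (22 / 663) := by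
    apply mul_le_mul_of_nonneg_right q3 (by norm_num)
  have h4' : ((u₄ : ℕ) : ℚ) * (22 / 1547) ≤ ((s 4 : ℕ) : ℚ) * (22 / 1547) := by
    apply mul_le_mul_of_nonneg_right q4 (by norm_num)
  linarith

/-- **One heavy side line**: `q ≥ 3` singletons off it and `C(t_A, 2) · q` triples, `q + t_A + 1 ≥ m ≥ 10`. -/
theorem dd_large_one (q tA : ℕ) (hq : 3 ≤ q) (hm : 10 ≤ q + tA + 1) :
    106 ≤ 21 * q + 7 * 0 + 3 * (tA.choose 2 * q) := by
  rcases Nat.lt_or_ge q 6 with h6 | h6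
  · have htA : 4 ≤ tA := by omega
    have hc : 6 ≤ tA.choose 2 := by
      have := Nat.choose_le_choose 2 htA
      rw [show Nat.choose 4 2 = 6 by decide] at this
      exact this
    have := Nat.mul_le_mul hc hq
    omega
  · omega

/-- **Both side lines heavy**: from the cell facts (`n_L + n_A + n_M = 4`, the three cells of size `≥ 3`, the
independence bounds, the side lines' excess `≤ 1`, `n₂, n₃ ≥ 2` heavy), `m = t_L + t_A + t_M ≥ 10`:
`21 (m − s₂ − s₃) + 7 t_A t_M + 3 t_A t_M t_L ≥ 106`. -/
theorem dd_large_both (nL nA nM tL tA tM n₂ s₂ n₃ s₃ : ℕ)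
    (h1 : nL + nA + nM = 4) (h3 : nL + nA ≤ 3) (h4 : nL + nM ≤ 3)
    (h5 : 3 ≤ tL + nL) (h6 : 3 ≤ nA + tA) (h7 : 3 ≤ nM + tM)
    (h8 : nA ≤ n₂ ∧ tA ≤ s₂ ∧ (n₂ - nA) + (s₂ - tA) ≤ 1)
    (h9 : nM ≤ n₃ ∧ tM ≤ s₃ ∧ (n₃ - nM) + (s₃ - tM) ≤ 1) (h10 : n₂ ≤ 2) (h11 : n₃ ≤ 2)
    (hA : 2 ≤ n₂) (hM : 2 ≤ n₃) (hm : 10 ≤ tL + tA + tM) :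
    106 ≤ 21 * (tL + tA + tM - s₂ - s₃) + 7 * (tA * tM) + 3 * (tA * tM * tL) := by
  obtain ⟨h8a, h8b, h8c⟩ := h8
  obtain ⟨h9a, h9b, h9c⟩ := h9
  obtain ⟨a, rfl⟩ : ∃ a, tA = a + 1 := ⟨tA - 1, by omega⟩
  obtain ⟨b, rfl⟩ : ∃ b, tM = b + 1 := ⟨tM - 1, by omega⟩
  have key : (a + 1) * (b + 1) = a * b + a + b + 1 := by ring
  rcases Nat.lt_or_ge tL 8 with h8 | h8
  · have p3 : 2 ≤ a + 1 → 2 * (b + 1) ≤ (a + 1) * (b + 1) := fun h => Nat.mul_le_mul_right (b + 1) h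
    have p4 : 2 ≤ b + 1 → 2 * (a + 1) ≤ (a + 1) * (b + 1) := fun h => by
      rw [mul_comm (a + 1) (b + 1)]; exact Nat.mul_le_mul_right (a + 1) h
    by_cases hA2 : 2 ≤ a + 1
    · have q3 := p3 hA2
      by_cases hM2 : 2 ≤ b + 1
      · have q4 := p4 hM2
        interval_cases tL <;> omega
      · interval_cases tL <;> omega
    · by_cases hM2 : 2 ≤ b + 1
      · have q4 := p4 hM2
        interval_cases tL <;> omega
      · interval_cases tL <;> omega
  · omega

end PercRepro.Shadow
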